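import Mathlib
import Summits.Ventures.PercRepro2.IteratedBK

/-!
# The `i = 0` row of STEP for every pattern of every graph, from the level-refined Reimer
statement (AS3)  (seat mine-b, cell pub-perc-repro2; conjectures/MINE-B.md §11.3)

Two-colour patterns: the edges `O` are open in both colours, the edges `Y` are split, every other
edge is closed.  For `γ ⊆ Y` (the blue `Y`-edges) the blue graph is `O ∪ γ` and the red graph is
`O ∪ (Y \ γ)`; `F` is the max-flow (`kDisj` of `Carries`: `k` pairwise edge-disjoint `s–t` paths).
The STEP count is `H(i,j) = #{γ ⊆ Y : F_R = i ∧ F_B ≥ j}` and STEP(i,j) is `H(i,j) ≤ H(i+1,j−1)`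
(`j ≥ i+2`; the invariant closing the parallel composition of strands, StepClosure.lean /
StepClosure3.lean).

**(AS3)** (`MINE-B.md` §11.3; exhaustive for all pairs of up-sets on ≤ 5 elements, ≈ 34 million
structured tests on 6 elements) is the abstract statement: for increasing events `A`, `B` on the
cube `𝒫(U)` and `ρ = U \ γ`,
  `#{γ : A □ B at γ ∧ ρ ∉ B} ≤ #{γ : γ ∈ A ∧ ρ ∈ B ∧ ¬ (B □ B at ρ)}`
— Reimer's counting inequality `#{A □ B} ≤ #{A ∩ B̄}` (`reimer_increasing`) with the red side
restricted to level `0` on the left and to level exactly `1` on the right.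

Here we record the reduction: **(AS3) on the `Y`-cube with `A = {F(O ∪ ·) ≥ j}`, `B = {O ∪ · carries}`
implies STEP(0, j+1) for the pattern `(O, Y)` of any finite multigraph** (`stepH_zero_of_AS3`):
`j+1` disjoint blue paths give disjoint witnesses of `A` and `B` inside `γ` (their `Y`-parts), `F_R = 0`
is `ρ ∉ B`, and a red configuration of level `≤ 1` (no two `Y`-disjoint red paths) has `F_R ≤ 1`.
The conjecture is stated as the predicate `AS3`; nothing here depends on its truth.
-/

open Finset

namespace Summit.Ventures.PercRepro2

namespace StepZero

open ReimerCube

variable {V : Type*} {E : Type*} [DecidableEq E]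

open Classical in
/-- **The level-refined Reimer statement (AS3)** for the cube `U` and the events `A`, `B`:
`#{γ ⊆ U : A □ B at γ ∧ U \ γ ∉ B} ≤ #{γ ⊆ U : A γ ∧ B (U \ γ) ∧ ¬ B □ B at U \ γ}`
(a conjecture for all increasing `A`, `B`, MINE-B.md §11.3). -/
def AS3 (U : Finset E) (A B : Finset E → Prop) : Prop :=
  (U.powerset.filter (fun γ => DOcc A B γ ∧ ¬ B (U \ γ))).card
    ≤ (U.powerset.filter (fun γ => A γ ∧ B (U \ γ) ∧ ¬ DOcc B B (U \ γ))).card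

/-- the pinned connection event: `O ∪ X` carries `s` to `t` -/
def pinCarries (ends : E → Sym2 V) (s t : V) (O : Finset E) (X : Finset E) : Prop :=
  Carries ends (O ∪ X) s t

/-- the pinned flow event `F(O ∪ X) ≥ k`: `k` pairwise edge-disjoint `s–t` paths in `O ∪ X` -/
def pinFlow (ends : E → Sym2 V) (s t : V) (O : Finset E) (k : ℕ) (X : Finset E) : Prop :=
  kDisj (fun T => Carries ends T s t) k (O ∪ X)

open Classical in
/-- the STEP count `H(i,j) = #{γ ⊆ Y : F(O ∪ (Y \ γ)) = i ∧ F(O ∪ γ) ≥ j}` of the pattern `(O, Y)`,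
in the blue variable `γ` (red `= Y \ γ`). -/
noncomputable def stepH (ends : E → Sym2 V) (s t : V) (O Y : Finset E) (i j : ℕ) : ℕ :=
  (Y.powerset.filter (fun γ => pinFlow ends s t O i (Y \ γ) ∧ ¬ pinFlow ends s t O (i + 1) (Y \ γ)
      ∧ pinFlow ends s t O j γ)).card

/-- `pinCarries` is increasing -/
lemma incr_pinCarries (ends : E → Sym2 V) (s t : V) (O : Finset E) :
    Incr (pinCarries ends s t O) :=
  fun _ _ h hS => Carries.mono (Finset.union_subset_union_right h) hS

/-- `pinFlow k` is increasing -/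
lemma incr_pinFlow (ends : E → Sym2 V) (s t : V) (O : Finset E) (k : ℕ) :
    Incr (pinFlow ends s t O k) :=
  fun _ _ h hS => incr_kDisj (fun T => Carries ends T s t) k (Finset.union_subset_union_right h) hS

/-- `pinFlow 0` always holds -/
lemma pinFlow_zero (ends : E → Sym2 V) (s t : V) (O X : Finset E) : pinFlow ends s t O 0 X :=
  trivial

/-- `pinFlow 1` is `pinCarries` -/
lemma pinFlow_one_iff (ends : E → Sym2 V) (s t : V) (O X : Finset E) :
    pinFlow ends s t O 1 X ↔ pinCarries ends s t O X :=
  kDisj_one_iff (incr_carries ends s t) (O ∪ X)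

/-- Trimming the pins off a disjoint-occurrence witness: `k+1` disjoint `s–t` paths in `O ∪ γ` give
disjoint subsets of `γ` witnessing `pinFlow k` and `pinCarries`. -/
lemma dOcc_of_pinFlow_succ (ends : E → Sym2 V) (s t : V) (O : Finset E) (k : ℕ) {γ : Finset E}
    (h : pinFlow ends s t O (k + 1) γ) :
    DOcc (pinFlow ends s t O k) (pinCarries ends s t O) γ := by
  obtain ⟨K, L, hK, hL, hKL, hA, hB⟩ := h
  refine ⟨L \ O, K \ O, ?_, ?_, ?_, ?_, ?_⟩
  · intro x hx
    rcases Finset.mem_union.mp (hL (Finset.mem_sdiff.mp hx).1) with h1 | h1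
    · exact absurd h1 (Finset.mem_sdiff.mp hx).2
    · exact h1
  · intro x hx
    rcases Finset.mem_union.mp (hK (Finset.mem_sdiff.mp hx).1) with h1 | h1
    · exact absurd h1 (Finset.mem_sdiff.mp hx).2
    · exact h1
  · exact Finset.disjoint_of_subset_left Finset.sdiff_subset
      (Finset.disjoint_of_subset_right Finset.sdiff_subset hKL.symm)
  · intro T hT
    apply hB
    intro x hx
    by_cases hxO : x ∈ O
    · exact Finset.mem_union_left _ hxO
    · exact Finset.mem_union_right _ (hT (Finset.mem_sdiff.mpr ⟨hx, hxO⟩))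
  · intro T hT
    apply hA
    intro x hx
    by_cases hxO : x ∈ O
    · exact Finset.mem_union_left _ hxO
    · exact Finset.mem_union_right _ (hT (Finset.mem_sdiff.mpr ⟨hx, hxO⟩))

/-- Two edge-disjoint red paths are `Y`-disjoint: `F(O ∪ ρ) ≥ 2` gives `pinCarries □ pinCarries` at `ρ`. -/
lemma dOcc_carries_of_pinFlow_two (ends : E → Sym2 V) (s t : V) (O : Finset E) {ρ : Finset E}
    (h : pinFlow ends s t O 2 ρ) :
    DOcc (pinCarries ends s t O) (pinCarries ends s t O) ρ := by
  have h' := dOcc_of_pinFlow_succ ends s t O 1 h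
  obtain ⟨K, L, hK, hL, hKL, hA, hB⟩ := h'
  exact ⟨K, L, hK, hL, hKL, fun T hT => (pinFlow_one_iff ends s t O T).mp (hA T hT), hB⟩

open Classical in
/-- **STEP(0, j+1) for the pattern `(O, Y)` of any finite multigraph, from (AS3) on its `Y`-cube:**
`#{γ ⊆ Y : F_R = 0 ∧ F_B ≥ j+1} ≤ #{γ ⊆ Y : F_R = 1 ∧ F_B ≥ j}`. -/
theorem stepH_zero_of_AS3 (ends : E → Sym2 V) (s t : V) (O Y : Finset E) (j : ℕ)
    (h : AS3 Y (pinFlow ends s t O j) (pinCarries ends s t O)) :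
    stepH ends s t O Y 0 (j + 1) ≤ stepH ends s t O Y 1 j := by
  unfold stepH
  unfold AS3 at h
  refine le_trans (Finset.card_le_card ?_) (le_trans h (Finset.card_le_card ?_))
  · intro γ hγ
    rw [Finset.mem_filter] at hγ ⊢
    obtain ⟨hY, -, hnot, hj⟩ := hγ
    refine ⟨hY, dOcc_of_pinFlow_succ ends s t O j hj, ?_⟩
    intro hB
    exact hnot ((pinFlow_one_iff ends s t O (Y \ γ)).mpr hB)
  · intro γ hγ
    rw [Finset.mem_filter] at hγ ⊢
    obtain ⟨hY, hA, hB, hnot⟩ := hγ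
    refine ⟨hY, (pinFlow_one_iff ends s t O (Y \ γ)).mpr hB, ?_, hA⟩
    intro h2
    exact hnot (dOcc_carries_of_pinFlow_two ends s t O h2)

/-! ## The joint tail `T(a,b)`, the colour swap, and the Reimer row STEP(0,2) unconditionally -/

open Classical in
/-- the joint tail `T(a,b) = #{γ ⊆ Y : F(O ∪ (Y \ γ)) ≥ a ∧ F(O ∪ γ) ≥ b}` of the pattern `(O, Y)` -/
noncomputable def stepT (ends : E → Sym2 V) (s t : V) (O Y : Finset E) (a b : ℕ) : ℕ :=
  (Y.powerset.filter (fun γ => pinFlow ends s t O a (Y \ γ) ∧ pinFlow ends s t O b γ)).card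

/-- `pinFlow (k+1)` implies `pinFlow k` -/
lemma pinFlow_of_succ (ends : E → Sym2 V) (s t : V) (O : Finset E) (k : ℕ) {X : Finset E}
    (h : pinFlow ends s t O (k + 1) X) : pinFlow ends s t O k X := by
  obtain ⟨_, L, _, hL, _, _, hB⟩ := h
  exact incr_kDisj (fun T => Carries ends T s t) k hL (hB L le_rfl)

open Classical in
/-- the colour swap `γ ↦ Y \ γ`: `T(a,b) = T(b,a)` -/
lemma stepT_swap (ends : E → Sym2 V) (s t : V) (O Y : Finset E) (a b : ℕ) :
    stepT ends s t O Y a b = stepT ends s t O Y b a := by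
  unfold stepT
  apply Finset.card_nbij' (fun γ => Y \ γ) (fun γ => Y \ γ)
  · intro γ hγ
    rw [Finset.coe_filter] at hγ ⊢
    obtain ⟨hY, h1, h2⟩ := hγ
    rw [Finset.mem_powerset] at hY
    refine ⟨Finset.mem_powerset.mpr Finset.sdiff_subset, ?_, h1⟩
    rw [Finset.sdiff_sdiff_eq_self hY]
    exact h2
  · intro γ hγ
    rw [Finset.coe_filter] at hγ ⊢
    obtain ⟨hY, h1, h2⟩ := hγ
    rw [Finset.mem_powerset] at hY
    refine ⟨Finset.mem_powerset.mpr Finset.sdiff_subset, ?_, h1⟩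
    rw [Finset.sdiff_sdiff_eq_self hY]
    exact h2
  · intro γ hγ
    rw [Finset.coe_filter] at hγ
    exact Finset.sdiff_sdiff_eq_self (Finset.mem_powerset.mp hγ.1)
  · intro γ hγ
    rw [Finset.coe_filter] at hγ
    exact Finset.sdiff_sdiff_eq_self (Finset.mem_powerset.mp hγ.1)

open Classical in
/-- `T(i,j) = T(i+1,j) + H(i,j)`: the tail splits at the red level -/
lemma stepT_eq_add_stepH (ends : E → Sym2 V) (s t : V) (O Y : Finset E) (i j : ℕ) :
    stepT ends s t O Y i j = stepT ends s t O Y (i + 1) j + stepH ends s t O Y i j := by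
  unfold stepT stepH
  rw [← Finset.card_filter_add_card_filter_not (fun γ => pinFlow ends s t O (i + 1) (Y \ γ))
    (s := Y.powerset.filter (fun γ => pinFlow ends s t O i (Y \ γ) ∧ pinFlow ends s t O j γ))]
  congr 1
  · rw [Finset.filter_filter]
    congr 1
    apply Finset.filter_congr
    intro γ _
    constructor
    · rintro ⟨⟨-, hj⟩, hi1⟩
      exact ⟨hi1, hj⟩
    · rintro ⟨hi1, hj⟩
      exact ⟨⟨pinFlow_of_succ ends s t O i hi1, hj⟩, hi1⟩
  · rw [Finset.filter_filter]
    congr 1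
    apply Finset.filter_congr
    intro γ _
    constructor
    · rintro ⟨⟨hi, hj⟩, hn⟩
      exact ⟨hi, hn, hj⟩
    · rintro ⟨hi, hn, hj⟩
      exact ⟨⟨hi, hj⟩, hn⟩

open Classical in
/-- **Reimer on the pattern: `T(0,2) ≤ T(1,1)`** — two disjoint blue paths give `B □ B` at `γ`, and
`reimer_increasing` bounds `#{B □ B}` by `#{B γ ∧ B (Y \ γ)}`. -/
lemma stepT_zero_two_le (ends : E → Sym2 V) (s t : V) (O Y : Finset E) :
    stepT ends s t O Y 0 2 ≤ stepT ends s t O Y 1 1 := by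
  unfold stepT
  have h := reimer_increasing Y (pinCarries ends s t O) (pinCarries ends s t O)
    (incr_pinCarries ends s t O) (incr_pinCarries ends s t O)
  refine le_trans (Finset.card_le_card ?_) (le_trans h (Finset.card_le_card ?_))
  · intro γ hγ
    rw [Finset.mem_filter] at hγ ⊢
    exact ⟨hγ.1, dOcc_carries_of_pinFlow_two ends s t O hγ.2.2⟩
  · intro γ hγ
    rw [Finset.mem_filter] at hγ ⊢
    exact ⟨hγ.1, (pinFlow_one_iff ends s t O _).mpr hγ.2.2, (pinFlow_one_iff ends s t O _).mpr hγ.2.1⟩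

/-- **STEP(0,2) for every pattern `(O, Y)` of every finite multigraph** (the first strand
inequality of MINE-B.md §10.3 / §11.1, unconditionally): `H(0,2) ≤ H(1,1)`, i.e.
`#{γ ⊆ Y : F_R = 0 ∧ F_B ≥ 2} ≤ #{γ ⊆ Y : F_R = 1 ∧ F_B ≥ 1}`. -/
theorem stepH_zero_two_le (ends : E → Sym2 V) (s t : V) (O Y : Finset E) :
    stepH ends s t O Y 0 2 ≤ stepH ends s t O Y 1 1 := by
  have h02 : stepT ends s t O Y 0 2 = stepT ends s t O Y 1 2 + stepH ends s t O Y 0 2 :=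
    stepT_eq_add_stepH ends s t O Y 0 2
  have h11 : stepT ends s t O Y 1 1 = stepT ends s t O Y 2 1 + stepH ends s t O Y 1 1 :=
    stepT_eq_add_stepH ends s t O Y 1 1
  have hsw := stepT_swap ends s t O Y 2 1
  have hR := stepT_zero_two_le ends s t O Y
  omega

end StepZero

end Summit.Ventures.PercRepro2
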